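import Summits.HodgeConjecture.CorCM.D2Bridge.UnitaryGroupFinAdelicConj
import Summits.HodgeConjecture.HodgeCM.Model.PerLOfCanonical
import Summits.HodgeConjecture.HodgeCM.Model.LiuDictionaryPin
import Summits.HodgeConjecture.CorCM.D2Bridge.Thm418CTransport
import Summits.HodgeConjecture.CorCM.D2Bridge.ReflexOfTypeConj
import HarnessLib

/-!
# Δ2 BRIDGE, sub-socket S-d — the STRUCTURAL legs of the `V ↦ V̄ := V.transposeAt ῑ₁` transport, K-functorially (§L2–§L3)

THIS FILE = §L2–§L3; §L1 = `CorCM/D2Bridge/UnitaryGroupFinAdelicConj.lean` (imported).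

Cell pub-hodgecm2 (COR-CM), wall-breaker seat wb-10 (prover-pub-hodgecm2-d2bridge-wb-10-g0-0), 2026-08-23; sequel to
`CorCM/D2Bridge/Thm418CTransport` (✔ p372132: `Thm418C` is invariant under a transport package `(φ, eL, eC, eH, eW)` + laws).
This file SUPPLIES the structural components of that package at a conjugate pair of pins `(V, ι₁)`, `(V.transposeAt ι₀ h, ι₀)`
(`conjugate ι₀ = ι₁`; tree `HodgeCM/Model/PerLOfCanonical`: same Picard code, same realised pieces), leaving exactly the automorphic-side
relabeling (`eC`, `eH`, block law, `res`∕`cmClasses` laws) as explicit binders of `thm418C_transposeAt_iff_of_transport`: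

* §L1 (`…D2Bridge.UnitaryGroupConj`, general `E/F`, `c ∈ Aut(E/F)`, `J ∈ M_N(E)`; Literature-grade transport of structure, kept next to
  its only consumer tonight): `glConj` = `c ⊗ 1` on `GL_N(𝔸_E^∞)` as `≃ₜ*`; **`finAdelicConj (hJ : c(J) = J') : U(J)(𝔸_{F,f}) ≃ₜ* U(J')(𝔸_{F,f})`**
  ([PlatonovRapinchuk1994, §5.1]: apply `c ⊗ 1` to the defining equation; inverse by `c⁻¹ ⊗ 1`; for `c`-hermitian `J`, `J' = Jᵀ`); its action
  on matrices; compatibility with the diagonal embedding `(c ⊗ 1)(γ)_f = (c γ)_f`; and **`arithmeticLevel_map_finAdelicConj`: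
  `Γ((c ⊗ 1) K) = c Γ(K)`** in `GL_N(E)`.
* §L2 (model currency): `adelicFinConj V ι₀ h : U(V)(𝔸_f) ≃ₜ* U(Vᵀ)(𝔸_f)`; **`levelConjAlong` ∕ `levelConjEquiv : Level V ≃o Level (V.transposeAt ι₀ h)`**
  transporting the compact open `K ↦ (c ⊗ 1) K` (K-FUNCTORIAL — unlike the tree's `Level.conjTransposeAt` ∕ `Level.relabel`, which re-choose
  `K` by `Level.ofCongruence`; so the order of levels and `K`-fixed vectors transport, `(eL K).K = φ K.K` by `rfl`);
  `pmsCode_levelConjAlong` ∕ **`pms_levelConjAlong`** (same realised piece); `cohCCast` (cohomology along an equality of varieties);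
  **`thm418C_transposeAt_iff_of_transport`** = S-d with `φ`, `eL`, `eW`, `hK` discharged.
* §L3 (at the PINNED dictionaries `liuDictionaryPin … V I line` ∕ `liuDictionaryPin … (V.transposeAt ι₀ h) Ī linē`): under an index relabeling
  `eC : I ≃ Ī` carrying lines to lines of CONJUGATE type (`(linē (eC i)).lineType = bar (line i).lineType` — the natural one: `muLiu ῑ₁ = −muLiu ι₁`),
  the record-side laws are THEOREMS — `phiMu_pin_transposeAt_iff` (`ι₁ ∈ Φ ↔ ῑ₁ ∈ Φ̄`), `adm_pin_transposeAt_iff` (✔ `ReflexOfTypeConj`),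
  `cmClasses_pin_transposeAt_eq` (generator sets correspond under the cast) — whence **`thm418C_pin_transposeAt_iff_of_transport`**: S-d with ONLY
  the automorphic-side relabeling left as binders (`eC` + type law, tower iso `eH` + semilinearity, block law, `res` law).

KERNEL: definitions by explicit formula + theorems; no instance, no named fact, no `sorry`; nothing cited anew as a record.  Orientation-neutral
(ORIENTATION-MEMO v1.3: S-d relabels the ι₁∕ῑ₁ seam, it does not remove it).  HC_CM is NOT proved; «Δ2 BRIDGE CLOSED» is NOT claimed.

## References
* V. Platonov, A. Rapinchuk, *Algebraic groups and number theory* (1994), §5.1 (adelic points; functoriality in the defining equations).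
* J. W. S. Cassels, A. Fröhlich (eds.), *Algebraic Number Theory* (1967), Ch. VII §1.1 (Galois action on adeles) — through the tree's
  `UnitaryGroup.conjFiniteAdele`.
-/

set_option autoImplicit false

noncomputable section

open NumberField IsDedekindDomain
open scoped Matrix MatrixGroups

/-! ## §L2  K-functorial transport of levels along `V ↦ V.transposeAt ι₀ h`, and the S-d corollary -/

namespace Summit.HodgeConjecture.CorCM.D2Bridge

open HodgeCM HodgeCM.Model NumberField NumberField.ComplexEmbedding
open Literature.NumberTheory.Automorphic Literature.NumberTheory.Automorphic.PicardCM
open Literature.AlgebraicGeometry.HodgeTheory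

variable {L : HodgeCM.CMField} {ι₀ ι₁ : (L : Type) →+* ℂ}

/-- `c⁻¹ = c` for the complex conjugation of a CM field (order two). [folklore] -/
theorem complexConj_inv (L : HodgeCM.CMField) :
    (IsCMField.complexConj (L : Type))⁻¹ = IsCMField.complexConj (L : Type) := by
  have h2 : IsCMField.complexConj (L : Type) * IsCMField.complexConj (L : Type) = 1 := by
    have h := pow_orderOf_eq_one (IsCMField.complexConj (L : Type))
    rwa [IsCMField.orderOf_complexConj, pow_two] at h
  exact inv_eq_of_mul_eq_one_right h2

/-- `c(V.Hm) = V.Hmᵀ` for a hermitian Gram matrix. [folklore] -/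
theorem hm_map_complexConj_eq_transpose (V : HodgeCM.HermSpace3 L ι₁) :
    V.Hm.map ((IsCMField.complexConj (L : Type) : (L : Type) ≃ₐ[↥(maximalRealSubfield (L : Type))] (L : Type)) :
      (L : Type) →+* (L : Type)) = V.Hmᵀ :=
  UnitaryGroupConj.map_galConj_eq_transpose_of_hermitian _ _ (IsCMField.complexConj (L : Type)) 3 fun i j => V.isHermitian i j

/-- The package's `conjAut L` as a ring hom IS the coercion of `IsCMField.complexConj L`. [folklore] -/
theorem conjAut_toRingHom_eq (L : HodgeCM.CMField) :
    (HodgeCM.CMTypeOps.conjAut L).toRingHom =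
      ((IsCMField.complexConj (L : Type) : (L : Type) ≃ₐ[↥(maximalRealSubfield (L : Type))] (L : Type)) : (L : Type) →+* (L : Type)) :=
  RingHom.ext fun _ => rfl

/-- **`c ⊗ 1 : U(V)(𝔸_f) ≃ₜ* U(V.transposeAt ι₀ h)(𝔸_f)`** — the finite-adelic unitary group of the conjugate-transposed space is the
Galois conjugate of that of `V` (`UnitaryGroupConj.finAdelicConj` at `J := V.Hm`, `J' := V.Hmᵀ`). [folklore] -/
def adelicFinConj (V : HodgeCM.HermSpace3 L ι₁) (ι₀ : (L : Type) →+* ℂ) (h : conjugate ι₀ = ι₁) :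
    ↥V.adelicFin ≃ₜ* ↥(V.transposeAt ι₀ h).adelicFin :=
  UnitaryGroupConj.finAdelicConj (↥(maximalRealSubfield (L : Type))) (L : Type) (IsCMField.complexConj (L : Type)) 3
    (hm_map_complexConj_eq_transpose V)

/-- `c(V.Hmᵀ) = V.Hm` (`c² = 1`). [folklore] -/
theorem hmT_map_complexConj_eq (V : HodgeCM.HermSpace3 L ι₁) :
    V.Hmᵀ.map ((IsCMField.complexConj (L : Type) : (L : Type) ≃ₐ[↥(maximalRealSubfield (L : Type))] (L : Type)) :
      (L : Type) →+* (L : Type)) = V.Hm := by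
  rw [← hm_map_complexConj_eq_transpose, Matrix.map_map]
  exact Matrix.ext fun i j => IsCMField.complexConj_apply_apply _ (V.Hm i j)

/-- the same, backwards: `U(Vᵀ)(𝔸_f) ≃ₜ* U(V)(𝔸_f)` along `c ⊗ 1` again (`c² = 1`). [folklore] -/
def adelicFinConjBack (V : HodgeCM.HermSpace3 L ι₁) (ι₀ : (L : Type) →+* ℂ) (h : conjugate ι₀ = ι₁) :
    ↥(V.transposeAt ι₀ h).adelicFin ≃ₜ* ↥V.adelicFin :=
  UnitaryGroupConj.finAdelicConj (↥(maximalRealSubfield (L : Type))) (L : Type) (IsCMField.complexConj (L : Type)) 3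
    (J := V.Hmᵀ) (J' := V.Hm) (hmT_map_complexConj_eq V)

/-- `(c ⊗ 1) ((c ⊗ 1) g) = g` on underlying matrices (`c² = 1`). [folklore] -/
theorem adelicFinConjBack_adelicFinConj (V : HodgeCM.HermSpace3 L ι₁) (ι₀ : (L : Type) →+* ℂ) (h : conjugate ι₀ = ι₁)
    (g : ↥V.adelicFin) : adelicFinConjBack V ι₀ h (adelicFinConj V ι₀ h g) = g := by
  have hs : adelicFinConjBack V ι₀ h (adelicFinConj V ι₀ h g) = (adelicFinConj V ι₀ h).symm (adelicFinConj V ι₀ h g) := by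
    refine Subtype.ext ?_
    change Matrix.GeneralLinearGroup.map (UnitaryGroup.conjFiniteAdele _ _ (IsCMField.complexConj (L : Type))) _ =
      Matrix.GeneralLinearGroup.map (UnitaryGroup.conjFiniteAdele _ _ (IsCMField.complexConj (L : Type))⁻¹) _
    rw [complexConj_inv]
  rw [hs]
  exact (adelicFinConj V ι₀ h).symm_apply_apply g

/-- `(c ⊗ 1) ((c ⊗ 1) g') = g'` on underlying matrices, the other composite. [folklore] -/
theorem adelicFinConj_adelicFinConjBack (V : HodgeCM.HermSpace3 L ι₁) (ι₀ : (L : Type) →+* ℂ) (h : conjugate ι₀ = ι₁)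
    (g' : ↥(V.transposeAt ι₀ h).adelicFin) : adelicFinConj V ι₀ h (adelicFinConjBack V ι₀ h g') = g' := by
  have hs : adelicFinConjBack V ι₀ h g' = (adelicFinConj V ι₀ h).symm g' := by
    refine Subtype.ext ?_
    change Matrix.GeneralLinearGroup.map (UnitaryGroup.conjFiniteAdele _ _ (IsCMField.complexConj (L : Type))) _ =
      Matrix.GeneralLinearGroup.map (UnitaryGroup.conjFiniteAdele _ _ (IsCMField.complexConj (L : Type))⁻¹) _
    rw [complexConj_inv]
  rw [hs]
  exact (adelicFinConj V ι₀ h).apply_symm_apply g'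

/-- **K-FUNCTORIAL transport of a level along `V ↦ V.transposeAt ι₀ h`**: `(Γ, K) ↦ (c Γ, (c ⊗ 1) K)`.  Unlike the tree's
`Level.conjTransposeAt` ∕ `Level.relabel` (which re-choose `K` through `Level.ofCongruence`), the compact open is TRANSPORTED, so that the
order of levels and `K`-fixed vectors transport with it (`arithmeticLevel_K` by `UnitaryGroupConj.arithmeticLevel_map_finAdelicConj`). [folklore] -/
def levelConjAlong {V : HodgeCM.HermSpace3 L ι₁} (Γ : HodgeCM.Level V) (ι₀ : (L : Type) →+* ℂ) (h : conjugate ι₀ = ι₁) :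
    HodgeCM.Level (V.transposeAt ι₀ h) where
  Γ := Γ.Γ.map (Matrix.GeneralLinearGroup.map (HodgeCM.CMTypeOps.conjAut L).toRingHom)
  K := Γ.K.map (adelicFinConj V ι₀ h).toMonoidHom
  isCompact_K := by
    rw [Subgroup.coe_map]
    exact Γ.isCompact_K.image (adelicFinConj V ι₀ h).continuous
  isOpen_K := by
    rw [Subgroup.coe_map]
    exact (adelicFinConj V ι₀ h).toHomeomorph.isOpenMap _ Γ.isOpen_K
  arithmeticLevel_K := by
    rw [conjAut_toRingHom_eq, ← Γ.arithmeticLevel_K]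
    exact UnitaryGroupConj.arithmeticLevel_map_finAdelicConj _ _ _ 3 (hm_map_complexConj_eq_transpose V) Γ.K
  torsionFree := Γ.torsionFree_conj

/-- the transported compact open is `(c ⊗ 1) K` (definitional). [folklore] -/
@[simp] theorem levelConjAlong_K {V : HodgeCM.HermSpace3 L ι₁} (Γ : HodgeCM.Level V) (ι₀ : (L : Type) →+* ℂ)
    (h : conjugate ι₀ = ι₁) :
    (levelConjAlong Γ ι₀ h).K = Γ.K.map (adelicFinConj V ι₀ h).toMonoidHom := rfl

/-- the transported arithmetic group is `c Γ` — the same as the tree's `Level.conjTransposeAt` (definitional). [folklore] -/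
theorem levelConjAlong_Γ {V : HodgeCM.HermSpace3 L ι₁} (Γ : HodgeCM.Level V) (ι₀ : (L : Type) →+* ℂ) (h : conjugate ι₀ = ι₁) :
    (levelConjAlong Γ ι₀ h).Γ = (Γ.conjTransposeAt ι₀ h).Γ := rfl

/-- **the way back**: `(Γ', K') ↦ (c Γ', (c ⊗ 1) K')` from the transposed space to `V`. [folklore] -/
def levelConjBack {V : HodgeCM.HermSpace3 L ι₁} {ι₀ : (L : Type) →+* ℂ} {h : conjugate ι₀ = ι₁}
    (Γ' : HodgeCM.Level (V.transposeAt ι₀ h)) : HodgeCM.Level V where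
  Γ := Γ'.Γ.map (Matrix.GeneralLinearGroup.map (HodgeCM.CMTypeOps.conjAut L).toRingHom)
  K := Γ'.K.map (adelicFinConjBack V ι₀ h).toMonoidHom
  isCompact_K := by
    rw [Subgroup.coe_map]
    exact Γ'.isCompact_K.image (adelicFinConjBack V ι₀ h).continuous
  isOpen_K := by
    rw [Subgroup.coe_map]
    exact (adelicFinConjBack V ι₀ h).toHomeomorph.isOpenMap _ Γ'.isOpen_K
  arithmeticLevel_K := by
    rw [conjAut_toRingHom_eq, ← Γ'.arithmeticLevel_K]
    exact UnitaryGroupConj.arithmeticLevel_map_finAdelicConj _ _ _ 3 (hmT_map_complexConj_eq V) Γ'.K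
  torsionFree := torsionFree_map (HodgeCM.CMTypeOps.conjAut L) Γ'.torsionFree

/-- **The ORDER ISOMORPHISM of levels `Level V ≃o Level (V.transposeAt ι₀ h)`** along `c ⊗ 1` (levels are ordered by their compact
opens, `Level.le_def`). [folklore] -/
def levelConjEquiv (V : HodgeCM.HermSpace3 L ι₁) (ι₀ : (L : Type) →+* ℂ) (h : conjugate ι₀ = ι₁) :
    HodgeCM.Level V ≃o HodgeCM.Level (V.transposeAt ι₀ h) where
  toFun Γ := levelConjAlong Γ ι₀ h
  invFun Γ' := levelConjBack Γ'
  left_inv Γ := by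
    refine HodgeCM.Level.ext ?_
    change (Γ.K.map (adelicFinConj V ι₀ h).toMonoidHom).map (adelicFinConjBack V ι₀ h).toMonoidHom = Γ.K
    rw [Subgroup.map_map]
    conv_rhs => rw [← Subgroup.map_id Γ.K]
    congr 1
    exact MonoidHom.ext fun g => adelicFinConjBack_adelicFinConj V ι₀ h g
  right_inv Γ' := by
    refine HodgeCM.Level.ext ?_
    change (Γ'.K.map (adelicFinConjBack V ι₀ h).toMonoidHom).map (adelicFinConj V ι₀ h).toMonoidHom = Γ'.K
    rw [Subgroup.map_map]
    conv_rhs => rw [← Subgroup.map_id Γ'.K]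
    congr 1
    exact MonoidHom.ext fun g => adelicFinConj_adelicFinConjBack V ι₀ h g
  map_rel_iff' := by
    intro Γ Γ'
    change (levelConjAlong Γ ι₀ h).K ≤ (levelConjAlong Γ' ι₀ h).K ↔ Γ.K ≤ Γ'.K
    rw [levelConjAlong_K, levelConjAlong_K]
    exact Subgroup.map_le_map_iff_of_injective (adelicFinConj V ι₀ h).injective

/-- `levelConjEquiv` on a level is `levelConjAlong` (definitional). [folklore] -/
@[simp] theorem levelConjEquiv_apply (V : HodgeCM.HermSpace3 L ι₁) (ι₀ : (L : Type) →+* ℂ) (h : conjugate ι₀ = ι₁)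
    (Γ : HodgeCM.Level V) : levelConjEquiv V ι₀ h Γ = levelConjAlong Γ ι₀ h := rfl

/-- `pmsCode` reads a level only through its arithmetic group. [folklore] -/
theorem pmsCode_congr_Γ {W : HodgeCM.HermSpace3 L ι₀} (Δ₁ Δ₂ : HodgeCM.Level W) (e : Δ₁.Γ = Δ₂.Γ) :
    pmsCode L ι₀ W Δ₁ = pmsCode L ι₀ W Δ₂ := by
  cases Δ₁; cases Δ₂; cases e; rfl

/-- **Same Picard code**: `pmsCode L ι₀ Vᵀ (c ⊗ 1 · Γ) = pmsCode L ι₁ V Γ` (the tree's `pmsCode_transposeAt`, K-functorial form). [folklore] -/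
theorem pmsCode_levelConjAlong (V : HodgeCM.HermSpace3 L ι₁) (Γ : HodgeCM.Level V) (ι₀ : (L : Type) →+* ℂ)
    (h : conjugate ι₀ = ι₁) : pmsCode L ι₀ (V.transposeAt ι₀ h) (levelConjAlong Γ ι₀ h) = pmsCode L ι₁ V Γ := by
  rw [pmsCode_congr_Γ _ _ (levelConjAlong_Γ Γ ι₀ h)]
  exact pmsCode_transposeAt V Γ ι₀ h

/-- **Same realised piece**: `U.pms L ι₀ Vᵀ (c ⊗ 1 · Γ) = U.pms L ι₁ V Γ` in the end-state universe. [folklore] -/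
theorem pms_levelConjAlong (hHD : exists_isReal_hodgeModel) (hI : hodgePQ_independent_of_hodgeModel)
    (h₁ : BallQuotientUniformised) (h₃ : CMAbelianVarietyRealised)
    (V : HodgeCM.HermSpace3 L ι₁) (Γ : HodgeCM.Level V) (ι₀ : (L : Type) →+* ℂ) (h : conjugate ι₀ = ι₁) :
    (picardCMUniverse hHD hI h₁ h₃).pms L ι₀ (V.transposeAt ι₀ h) (levelConjAlong Γ ι₀ h) =
      (picardCMUniverse hHD hI h₁ h₃).pms L ι₁ V Γ := by
  change (universeOf hHD hI _ h₃).pms L ι₀ _ _ = (universeOf hHD hI _ h₃).pms L ι₁ V Γ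
  rw [universeOf_pms, universeOf_pms, pmsCode_levelConjAlong]

/-- Complexified cohomology in a fixed degree along an equality of varieties of the universe (a cast, packaged as a `ℂ`-linear
isomorphism so that it composes with the transport package). [folklore] -/
def cohCCast (U : HodgeCM.Universe) {X Y : U.Var} (e : X = Y) (k : ℕ) : U.CohC X k ≃ₗ[ℂ] U.CohC Y k :=
  e ▸ LinearEquiv.refl ℂ _

/-- `cohCCast rfl = id`. [folklore] -/
@[simp] theorem cohCCast_rfl (U : HodgeCM.Universe) (X : U.Var) (k : ℕ) (x : U.CohC X k) : cohCCast U rfl k x = x := rfl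

open HodgeCM.Literature.Theta HodgeCM.Literature.Theta.LiuAlbaneseModuleDatum in
/-- **S-d AT THE CONJUGATE-TRANSPOSED PIN, structural legs DISCHARGED.**  For dictionaries `T₁` at `(V, ι₁)` and `T₂` at
`(V.transposeAt ι₀ h, ι₀)` (`conjugate ι₀ = ι₁`; same Picard codes, same realised pieces), `T₁.Thm418C ↔ T₂.Thm418C` along the REMAINING
(automorphic-side) data only: a bijection of characters `eC` matching `PhiMu`, a `(c ⊗ 1)`-semilinear isomorphism of towers `eH` matching
the `μ`-blocks, and the two laws `hres` ∕ `hcm` relating `res` and `cmClasses` through the CAST `cohCCast` over `pms_levelConjAlong` — the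
group isomorphism `φ := adelicFinConj`, the order isomorphism of levels `eL := levelConjEquiv` with `(eL K).K = φ K.K` by `rfl`, and the
cohomology isomorphisms `eW K := cohCCast …` are SUPPLIED here (`thm418C_iff_of_transport`).  [folklore] -/
theorem thm418C_transposeAt_iff_of_transport
    {hHD : exists_isReal_hodgeModel} {hI : hodgePQ_independent_of_hodgeModel}
    {h₁ : BallQuotientUniformised} {h₃ : CMAbelianVarietyRealised}
    (V : HodgeCM.HermSpace3 L ι₁) (ι₀ : (L : Type) →+* ℂ) (h : conjugate ι₀ = ι₁)
    (T₁ : LiuDictionary hHD hI h₁ h₃ V) (T₂ : LiuDictionary hHD hI h₁ h₃ (V.transposeAt ι₀ h))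
    (eC : T₁.Char ≃ T₂.Char) (eH : T₁.H ≃ₗ[ℂ] T₂.H)
    (heH : ∀ (g : ↥V.adelicFin) (x : T₁.H),
      eH (MonoidAlgebra.of ℂ ↥V.adelicFin g • x) = MonoidAlgebra.of ℂ ↥(V.transposeAt ι₀ h).adelicFin (adelicFinConj V ι₀ h g) • eH x)
    (hPhi : ∀ μ : T₁.Char, T₁.PhiMu μ ↔ T₂.PhiMu (eC μ))
    (hblock : ∀ μ : T₁.Char, (T₁.block μ).map (eH : T₁.H →ₗ[ℂ] T₂.H) = T₂.block (eC μ))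
    (hres : ∀ (K : HodgeCM.Level V) (x : T₁.H),
      cohCCast (picardCMUniverse hHD hI h₁ h₃) (pms_levelConjAlong hHD hI h₁ h₃ V K ι₀ h).symm 1 (T₁.res K x) =
        T₂.res (levelConjAlong K ι₀ h) (eH x))
    (hcm : ∀ (K : HodgeCM.Level V) (μ : T₁.Char),
      T₂.cmClasses (levelConjAlong K ι₀ h) (eC μ) =
        cohCCast (picardCMUniverse hHD hI h₁ h₃) (pms_levelConjAlong hHD hI h₁ h₃ V K ι₀ h).symm 1 '' T₁.cmClasses K μ) :
    T₁.Thm418C ↔ T₂.Thm418C :=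
  thm418C_iff_of_transport T₁ T₂ (adelicFinConj V ι₀ h).toMulEquiv (levelConjEquiv V ι₀ h) eC eH
    (fun K => cohCCast (picardCMUniverse hHD hI h₁ h₃) (pms_levelConjAlong hHD hI h₁ h₃ V K ι₀ h).symm 1)
    (fun _ => rfl) heH hPhi hblock hres hcm

/-! ## §L3  The record-side laws at the PINNED dictionaries: `PhiMu` and `cmClasses` under an index relabeling with conjugate types -/

section PinLaws

open HodgeCM.Literature.Theta HodgeCM.Literature.Theta.LiuAlbaneseModuleDatum
open Literature.NumberTheory.Transcendental (Arapura2012_Cor_15_4_6)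
open Literature.AlgebraicGeometry.HodgeTheory.BettiUniverse (pull)

/-- `conjugate ι₀ = ι₁ ⇒ ι₀ = conj ∘ ι₁`. [folklore] -/
theorem eq_starRingEnd_comp_of_conjugate_eq (h : conjugate ι₀ = ι₁) : ι₀ = (starRingEnd ℂ).comp ι₁ := by
  subst h
  exact (NumberField.ComplexEmbedding.involutive_conjugate (L : Type) ι₀).symm

/-- **`PhiMu` law.**  If the index relabeling `eC` carries each line to a line of CONJUGATE type, the `PhiMu` predicates of the pinned
dictionaries at `(V, ι₁)` and `(V.transposeAt ι₀ h, ι₀)` agree: `ι₁ ∈ Φ ↔ ῑ₁ ∈ Φ̄`. [folklore] -/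
theorem phiMu_pin_transposeAt_iff
    (hHD : exists_isReal_hodgeModel) (hI : hodgePQ_independent_of_hodgeModel)
    (h₁ : BallQuotientUniformised) (h₃ : CMAbelianVarietyRealised) (hA : Arapura2012_Cor_15_4_6)
    (V : HodgeCM.HermSpace3 L ι₁) (ι₀ : (L : Type) →+* ℂ) (h : conjugate ι₀ = ι₁)
    {I Ī : Type} (line : I → SplitLineE V) (linē : Ī → SplitLineE (V.transposeAt ι₀ h)) (eC : I → Ī)
    (hline : ∀ i, (linē (eC i)).lineType = HodgeCM.CMTypeOps.bar (line i).lineType) (i : I) :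
    (liuDictionaryPin hHD hI h₁ h₃ hA V I line).PhiMu i ↔
      (liuDictionaryPin hHD hI h₁ h₃ hA (V.transposeAt ι₀ h) Ī linē).PhiMu (eC i) := by
  show ι₁ ∈ ((line i).lineType).1 ↔ ι₀ ∈ ((linē (eC i)).lineType).1
  rw [hline i, HodgeCM.CMTypeOps.mem_bar_iff, eq_starRingEnd_comp_of_conjugate_eq h]
  exact HodgeCM.CMTypeOps.mem_iff_conjugate_notMem _ ι₁

/-- **`adm` law.**  Under the same relabeling the admissibility predicates agree record by record:
`IsReflexOfTypeG ῑ₁ Φ̄ ↔ IsReflexOfTypeG ι₁ Φ` (✔ `ReflexOfTypeConj`). [folklore] -/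
theorem adm_pin_transposeAt_iff
    (hHD : exists_isReal_hodgeModel) (hI : hodgePQ_independent_of_hodgeModel)
    (h₁ : BallQuotientUniformised) (h₃ : CMAbelianVarietyRealised) (hA : Arapura2012_Cor_15_4_6)
    (V : HodgeCM.HermSpace3 L ι₁) (ι₀ : (L : Type) →+* ℂ) (h : conjugate ι₀ = ι₁)
    {I Ī : Type} (line : I → SplitLineE V) (linē : Ī → SplitLineE (V.transposeAt ι₀ h)) (eC : I → Ī)
    (hline : ∀ i, (linē (eC i)).lineType = HodgeCM.CMTypeOps.bar (line i).lineType) (i : I) (d : LiuCMSide) :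
    (liuDictionaryPin hHD hI h₁ h₃ hA (V.transposeAt ι₀ h) Ī linē).adm (eC i) d ↔
      (liuDictionaryPin hHD hI h₁ h₃ hA V I line).adm i d := by
  show d.IsReflexOfTypeG ι₀ (linē (eC i)).lineType ↔ d.IsReflexOfTypeG ι₁ (line i).lineType
  rw [hline i, eq_starRingEnd_comp_of_conjugate_eq h, isReflexOfTypeG_conj_iff, HodgeCM.CMTypeOps.bar_bar]

/-- The generator sets read a Picard code and an admissibility predicate only: EQUAL codes and EQUIVALENT predicates give generator sets
that correspond under the cohomology cast. [folklore] -/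
theorem iUnion_range_geomClass_eq_image_cast
    (hHD : exists_isReal_hodgeModel) (hI : hodgePQ_independent_of_hodgeModel)
    (hU : BallQuotientUniformisedDatum) (h₃ : CMAbelianVarietyRealised)
    {c₁ c₂ : PicardCode} (hc : c₂ = c₁) (adm₁ adm₂ : LiuCMSide → Prop) (hadm : ∀ d, adm₂ d ↔ adm₁ d) :
    (⋃ d : LiuCMSide, ⋃ (_ : adm₂ d),
        Set.range fun f : (pmsRealisation hU c₂).X ⟶ d.A.X => (pull f 1).baseChange ℂ d.α) =
      cohCCast (universeOf hHD hI hU h₃) (congrArg Var.pms hc).symm 1 ''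
        (⋃ d : LiuCMSide, ⋃ (_ : adm₁ d),
          Set.range fun f : (pmsRealisation hU c₁).X ⟶ d.A.X => (pull f 1).baseChange ℂ d.α) := by
  subst hc
  have hid : (cohCCast (universeOf hHD hI hU h₃) (congrArg Var.pms (rfl : c₂ = c₂)).symm 1 :
      (universeOf hHD hI hU h₃).CohC (Var.pms c₂) 1 → (universeOf hHD hI hU h₃).CohC (Var.pms c₂) 1) = id := rfl
  rw [hid, Set.image_id]
  exact Set.iUnion_congr fun d => iSup_congr_Prop (hadm d) fun _ => rfl

/-- **`cmClasses` law.**  At the conjugate-transposed pin, with the index relabeling carrying lines to lines of conjugate type, the r8 generator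
sets correspond under the cast along `pms_levelConjAlong` (same realised piece, equivalent admissibility). [folklore] -/
theorem cmClasses_pin_transposeAt_eq
    (hHD : exists_isReal_hodgeModel) (hI : hodgePQ_independent_of_hodgeModel)
    (h₁ : BallQuotientUniformised) (h₃ : CMAbelianVarietyRealised) (hA : Arapura2012_Cor_15_4_6)
    (V : HodgeCM.HermSpace3 L ι₁) (ι₀ : (L : Type) →+* ℂ) (h : conjugate ι₀ = ι₁)
    {I Ī : Type} (line : I → SplitLineE V) (linē : Ī → SplitLineE (V.transposeAt ι₀ h)) (eC : I → Ī)
    (hline : ∀ i, (linē (eC i)).lineType = HodgeCM.CMTypeOps.bar (line i).lineType) (K : HodgeCM.Level V) (i : I) :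
    (liuDictionaryPin hHD hI h₁ h₃ hA (V.transposeAt ι₀ h) Ī linē).cmClasses (levelConjAlong K ι₀ h) (eC i) =
      cohCCast (picardCMUniverse hHD hI h₁ h₃) (pms_levelConjAlong hHD hI h₁ h₃ V K ι₀ h).symm 1 ''
        (liuDictionaryPin hHD hI h₁ h₃ hA V I line).cmClasses K i :=
  iUnion_range_geomClass_eq_image_cast hHD hI (ballQuotientUniformisedDatum_of h₁) h₃ (pmsCode_levelConjAlong V K ι₀ h) _ _
    (adm_pin_transposeAt_iff hHD hI h₁ h₃ hA V ι₀ h line linē eC hline i)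

/-- **S-d AT THE PINNED DICTIONARIES, record side DISCHARGED.**  `Thm418C` of the pinned dictionary at `(V, ι₁)` with index `(I, line)` ↔
`Thm418C` of the pinned dictionary at `(V.transposeAt ι₀ h, ι₀)` with index `(Ī, linē)`, along: an index bijection `eC` carrying lines to lines
of CONJUGATE type, and the automorphic-side relabeling — a `(c ⊗ 1)`-semilinear tower isomorphism `eH` matching the blocks and intertwining
the identity-component restrictions `res` through the cast.  Everything else (`φ`, `eL`, `eW`, `hK`, `hPhi`, `hcm`) is supplied. [folklore] -/
theorem thm418C_pin_transposeAt_iff_of_transport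
    (hHD : exists_isReal_hodgeModel) (hI : hodgePQ_independent_of_hodgeModel)
    (h₁ : BallQuotientUniformised) (h₃ : CMAbelianVarietyRealised) (hA : Arapura2012_Cor_15_4_6)
    (V : HodgeCM.HermSpace3 L ι₁) (ι₀ : (L : Type) →+* ℂ) (h : conjugate ι₀ = ι₁)
    {I Ī : Type} (line : I → SplitLineE V) (linē : Ī → SplitLineE (V.transposeAt ι₀ h)) (eC : I ≃ Ī)
    (hline : ∀ i, (linē (eC i)).lineType = HodgeCM.CMTypeOps.bar (line i).lineType)
    (eH : (liuDictionaryPin hHD hI h₁ h₃ hA V I line).H ≃ₗ[ℂ] (liuDictionaryPin hHD hI h₁ h₃ hA (V.transposeAt ι₀ h) Ī linē).H)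
    (heH : ∀ (g : ↥V.adelicFin) (x : (liuDictionaryPin hHD hI h₁ h₃ hA V I line).H),
      eH (MonoidAlgebra.of ℂ ↥V.adelicFin g • x) = MonoidAlgebra.of ℂ ↥(V.transposeAt ι₀ h).adelicFin (adelicFinConj V ι₀ h g) • eH x)
    (hblock : ∀ i : I, ((liuDictionaryPin hHD hI h₁ h₃ hA V I line).block i).map
        (eH : (liuDictionaryPin hHD hI h₁ h₃ hA V I line).H →ₗ[ℂ] (liuDictionaryPin hHD hI h₁ h₃ hA (V.transposeAt ι₀ h) Ī linē).H) =
      (liuDictionaryPin hHD hI h₁ h₃ hA (V.transposeAt ι₀ h) Ī linē).block (eC i))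
    (hres : ∀ (K : HodgeCM.Level V) (x : (liuDictionaryPin hHD hI h₁ h₃ hA V I line).H),
      cohCCast (picardCMUniverse hHD hI h₁ h₃) (pms_levelConjAlong hHD hI h₁ h₃ V K ι₀ h).symm 1
          ((liuDictionaryPin hHD hI h₁ h₃ hA V I line).res K x) =
        (liuDictionaryPin hHD hI h₁ h₃ hA (V.transposeAt ι₀ h) Ī linē).res (levelConjAlong K ι₀ h) (eH x)) :
    (liuDictionaryPin hHD hI h₁ h₃ hA V I line).Thm418C ↔ (liuDictionaryPin hHD hI h₁ h₃ hA (V.transposeAt ι₀ h) Ī linē).Thm418C :=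
  thm418C_transposeAt_iff_of_transport V ι₀ h _ _ eC eH heH
    (phiMu_pin_transposeAt_iff hHD hI h₁ h₃ hA V ι₀ h line linē eC hline) hblock hres
    (cmClasses_pin_transposeAt_eq hHD hI h₁ h₃ hA V ι₀ h line linē eC hline)

end PinLaws

end Summit.HodgeConjecture.CorCM.D2Bridge

end
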